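import Mathlib
import Literature.NumberTheory.LFunctions.Zhang2022.Section7dStatements
import Literature.NumberTheory.LFunctions.Zhang2022.Section5Lemma54PartOne
import Literature.NumberTheory.LFunctions.Zhang2022.KappaLSeries
import HarnessLib

/-!
# Zhang (2022) §7, (7.19): "the innermost sum is, by the Mellin transform, equal to
# `(1/2πi)∫_{(3/2)} (Σ_{(l,d₂k)=1} κ(d₁l)l^{−s}) (pk/l₂)^s δ(s) ds`" — DISCHARGED

Topic `Literature/NumberTheory/LFunctions/Zhang2022` (Landau–Siegel adjudication tree;
verdict-neutral). Y. Zhang, *Discrete mean estimates and the Landau–Siegel zero*,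
arXiv:2211.02515v1 (2022) [Zhang2022LandauSiegel], §7 "Proof of Proposition 7.1: the main term",
PDF p. 40, display (7.19), tex L2093; DAG node `Z22:(7.19)`:

> The innermost sum is, by the Mellin transform, equal to
> `(1/2πi)∫_{(3/2)} (Σ_{(l,d₂k)=1} κ(d₁l)/l^s) (pk/l₂)^s δ(s) ds`   (7.19)
> (here we have rewritten `l` for `l₁`).

The typed node is `Section7dStatements.Eq719 c′` (`TypedSection` slice L2-t5):
`Σ'_{l ≥ 1, (l,d₂k)=1} κ(d₁l)Δ(l·y) = mellinInv (3/2) (s ↦ (Σ'_{(l,d₂k)=1} κ(d₁l)l^{−s})·δ(s)) y`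
at `y = l₂/(pk)` (`Δ = Skeleton.DeltaW`, `δ = Skeleton.deltaW` (5.14) `= ∫₀^∞ Δ(x)x^{s−1}dx`,
`κ = Skeleton.kappaZ`). This file PROVES it (`eq719_holds`), for every modulus `D ≥ 3` (so in
particular eventually), with no use of (A):

1. `δ = mellin Δ` (definitional up to the order of the factors), and Mellin inversion on the line
   `σ = 3/2` (Mathlib `mellinInv_mellin_eq`): the Mellin integral converges absolutely for `σ > 0`
   (tree `Lemma53.integrableOn_Delta510_mul_cpow`), `t ↦ δ(3/2+it)` is integrable (tree
   `Lemma53.norm_delta514_le`: `‖δ(s)‖ ≤ K/‖s‖²` on `1/2 ≤ σ ≤ 2`, and continuity from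
   `Lemma53.differentiableOn_delta514`), `Δ` is continuous (`Lemma53.continuous_Delta510`);
   so `Δ(x) = (1/2π)∫ x^{−(3/2+it)} δ(3/2+it) dt` for `x > 0`.
2. Summing over `l`: the interchange `Σ_l ∫_t = ∫_t Σ_l`
   (`MeasureTheory.integral_tsum_of_summable_integral_norm`) is justified by
   `Σ_l |κ(d₁l)| l^{−3/2} < ∞` (tree `MeanSquareMajorant.LSeriesSummable_kappa` at `σ = 3/2`,
   re-indexed along `l ↦ d₁l`), and `(ly)^{−s} = l^{−s}y^{−s}`.

No new definitions, no named facts, no `sorry`; nothing here bears on the contour shift of the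
next step (node `Z22:§7.u047`, the referees' "(7.19) contour" item), on Theorems 1–2 of the source,
or on Landau–Siegel zeros.

## References

* Y. Zhang, arXiv:2211.02515v1 (2022), §7 (7.19) p. 40, tex L2093; §5 (5.14).
  [cite: Zhang2022LandauSiegel, (7.19) p.40]
-/

noncomputable section

open Complex Real MeasureTheory Set Filter

namespace Literature.NumberTheory.LFunctions.Zhang2022.Section7dStatements

/-! ## `δ = mellin Δ` and the vertical integrability of `δ` on `σ = 3/2` -/

/-- `𝓛₂ = 𝓛⁴⁰⁰ ≥ 1` for `D ≥ 3` (`𝓛 = log D > 1`). [cite: Zhang2022LandauSiegel, §2 (2.15)] -/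
private theorem one_le_ell2 {D : ℕ} (hD : 3 ≤ D) : 1 ≤ Skeleton.ell2 D := by
  have hD' : (3 : ℝ) ≤ D := by exact_mod_cast hD
  have h1 : (1 : ℝ) < Real.log 3 := by
    rw [Real.lt_log_iff_exp_lt (by norm_num)]
    exact Real.exp_one_lt_d9.trans (by norm_num)
  have hℓ : 1 ≤ Skeleton.ell D := le_trans h1.le (Real.log_le_log (by norm_num) hD')
  exact one_le_pow₀ hℓ

/-- **`δ(s) = ∫₀^∞ Δ(x)x^{s−1}dx` is the Mellin transform of `Δ`** ((5.14); Mathlib's `mellin`).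
[cite: Zhang2022LandauSiegel, §5 (5.14)] -/
theorem deltaW_eq_mellin (D : ℕ) :
    Skeleton.deltaW D = mellin (Lemma53.Delta510 (Skeleton.ell2 D) (Skeleton.t0 D)) := by
  funext s
  rw [Skeleton.deltaW, Lemma53.delta514, mellin]
  refine setIntegral_congr_fun measurableSet_Ioi fun x _ => ?_
  rw [smul_eq_mul, mul_comm]

/-- **`Δ(x) = Δ₅₁₀(x)` for `x > 0`**: the skeleton's `Δ` ((5.7), `Skeleton.DeltaW`) is the tree's
(5.10) form on the positive axis (`Lemma53.Delta57_eq_Delta510`). [cite: Zhang2022LandauSiegel, §5 (5.10)] -/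
theorem DeltaW_eq_Delta510 {D : ℕ} (hD : 3 ≤ D) {x : ℝ} (hx : 0 < x) :
    Skeleton.DeltaW D x = Lemma53.Delta510 (Skeleton.ell2 D) (Skeleton.t0 D) x := by
  rw [Skeleton.DeltaW]
  exact Lemma53.Delta57_eq_Delta510 (by linarith [one_le_ell2 hD]) _ hx

/-- **Lemma 5.4 (i) on the line `σ = 3/2`**: `‖δ(3/2+it)‖ ≤ K(1+t²)⁻¹` with some `K ≥ 0`
(tree `Lemma53.norm_delta514_le`, `‖3/2+it‖² ≥ 1+t²`). [cite: Zhang2022LandauSiegel, §5 Lemma 5.4 (i)] -/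
theorem exists_norm_deltaW_line_le {D : ℕ} (hD : 3 ≤ D) :
    ∃ K : ℝ, 0 ≤ K ∧ ∀ t : ℝ,
      ‖Skeleton.deltaW D (((3 / 2 : ℝ) : ℂ) + t * I)‖ ≤ K * (1 + t ^ 2)⁻¹ := by
  set K : ℝ := ∫ x in Ioi (0 : ℝ), ‖Lemma53.phaseInt 2 (Skeleton.ell2 D) (Skeleton.t0 D) x‖ *
    (x ^ (3 / 2 : ℝ) + x ^ (3 : ℝ)) with hK
  have hK0 : 0 ≤ K := setIntegral_nonneg measurableSet_Ioi fun x hx => by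
    have hx' : (0 : ℝ) < x := hx
    positivity
  refine ⟨K, hK0, fun t => ?_⟩
  set s : ℂ := ((3 / 2 : ℝ) : ℂ) + t * I with hs
  have hre : s.re = 3 / 2 := by simp [hs]
  have h := Lemma53.norm_delta514_le (one_le_ell2 hD) (Skeleton.t0 D) (s := s)
    (by rw [hre]; norm_num) (by rw [hre]; norm_num)
  have hnorm : ‖s‖ ^ 2 = 9 / 4 + t ^ 2 := by
    rw [Complex.sq_norm, Complex.normSq_apply]
    simp [hs]
    ring
  have h1 : (1 + t ^ 2)⁻¹ * K ≥ K / ‖s‖ ^ 2 := by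
    rw [hnorm, ge_iff_le, div_le_iff₀ (by positivity)]
    have : K ≤ (1 + t ^ 2)⁻¹ * K * (9 / 4 + t ^ 2) := by
      have h94 : 1 + t ^ 2 ≤ 9 / 4 + t ^ 2 := by linarith
      have hpos : 0 < 1 + t ^ 2 := by positivity
      calc K = (1 + t ^ 2)⁻¹ * K * (1 + t ^ 2) := by field_simp
        _ ≤ (1 + t ^ 2)⁻¹ * K * (9 / 4 + t ^ 2) := by
            exact mul_le_mul_of_nonneg_left h94 (by positivity)
    exact this
  calc ‖Skeleton.deltaW D s‖ ≤ K / ‖s‖ ^ 2 := h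
    _ ≤ (1 + t ^ 2)⁻¹ * K := h1
    _ = K * (1 + t ^ 2)⁻¹ := mul_comm _ _

/-- `t ↦ δ(3/2 + it)` is continuous (`δ` is holomorphic on `σ > 0`, `Lemma53.differentiableOn_delta514`).
[cite: Zhang2022LandauSiegel, §5 (5.14)] -/
theorem continuous_deltaW_line {D : ℕ} (hD : 3 ≤ D) :
    Continuous fun t : ℝ => Skeleton.deltaW D (((3 / 2 : ℝ) : ℂ) + t * I) := by
  have hdiff := Lemma53.differentiableOn_delta514 (one_le_ell2 hD) (Skeleton.t0 D)
  have hcont : ContinuousOn (Skeleton.deltaW D) {s : ℂ | 0 < s.re} := by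
    intro s hs
    exact (hdiff s hs).continuousWithinAt
  refine hcont.comp_continuous (by fun_prop) fun t => ?_
  show 0 < (((3 / 2 : ℝ) : ℂ) + t * I).re
  simp

/-- **`δ` is integrable along `σ = 3/2`** (`VerticalIntegrable (mellin Δ) (3/2)`).
[cite: Zhang2022LandauSiegel, §5 Lemma 5.4 (i)] -/
theorem integrable_deltaW_line {D : ℕ} (hD : 3 ≤ D) :
    Integrable fun t : ℝ => Skeleton.deltaW D (((3 / 2 : ℝ) : ℂ) + t * I) := by
  obtain ⟨K, -, hK⟩ := exists_norm_deltaW_line_le hD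
  refine Integrable.mono' (integrable_inv_one_add_sq.const_mul K)
    (continuous_deltaW_line hD).aestronglyMeasurable (Eventually.of_forall fun t => ?_)
  exact hK t

/-- **Mellin inversion for `Δ` on `σ = 3/2`**: `Δ(x) = (1/2π)∫ x^{−(3/2+it)}δ(3/2+it)dt` for
`x > 0` — "by the Mellin transform" of (7.19), for a single term. [cite: Zhang2022LandauSiegel, (7.19) p.40] -/
theorem DeltaW_eq_mellinInv {D : ℕ} (hD : 3 ≤ D) {x : ℝ} (hx : 0 < x) :
    Skeleton.DeltaW D x = mellinInv (3 / 2) (Skeleton.deltaW D) x := by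
  have hL : 1 ≤ Skeleton.ell2 D := one_le_ell2 hD
  have hconv : MellinConvergent (Lemma53.Delta510 (Skeleton.ell2 D) (Skeleton.t0 D))
      ((3 / 2 : ℝ) : ℂ) := by
    have h := Lemma53.integrableOn_Delta510_mul_cpow hL (Skeleton.t0 D) (s := ((3 / 2 : ℝ) : ℂ))
      (by simp)
    refine (h.congr_fun (fun y _ => ?_) measurableSet_Ioi)
    rw [smul_eq_mul, mul_comm]
  have hvert : VerticalIntegrable (mellin (Lemma53.Delta510 (Skeleton.ell2 D) (Skeleton.t0 D)))
      (3 / 2) := by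
    rw [VerticalIntegrable, ← deltaW_eq_mellin]
    exact integrable_deltaW_line hD
  have hcont : ContinuousAt (Lemma53.Delta510 (Skeleton.ell2 D) (Skeleton.t0 D)) x :=
    (Lemma53.continuous_Delta510 (by linarith) _).continuousAt
  rw [DeltaW_eq_Delta510 hD hx, deltaW_eq_mellin]
  exact (mellinInv_mellin_eq (3 / 2) _ hx hconv hvert hcont).symm

/-! ## Summability of `l ↦ κ(d₁l)l^{−3/2}` -/

/-- `Σ_l |κ(d₁l)| l^{−3/2} < ∞`: a sub-series of `Σ_n |κ(n)| n^{−3/2}` up to the factor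
`d₁^{3/2}` (tree `MeanSquareMajorant.LSeriesSummable_kappa`). [cite: Zhang2022LandauSiegel, §7 p.34] -/
theorem summable_norm_kappaZ_mul_rpow (c' : ℝ) (D : ℕ) {d₁ : ℕ} (hd₁ : 0 < d₁) :
    Summable fun l : ℕ => ‖Skeleton.kappaZ c' D (d₁ * l)‖ * (l : ℝ) ^ (-(3 / 2 : ℝ)) := by
  set s₀ : ℂ := ((3 / 2 : ℝ) : ℂ) with hs₀
  have hre : s₀.re = 3 / 2 := by simp [hs₀]
  have hsum : LSeriesSummable (fun n => Skeleton.kappaZ c' D n) s₀ := by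
    have h := MeanSquareMajorant.LSeriesSummable_kappa (Skeleton.b1 c' D) (Skeleton.b2 c' D)
      (Skeleton.b3 c' D) (s := s₀) (by rw [hre]; norm_num)
    simpa [Skeleton.kappaZ] using h
  have hnorm : Summable fun n : ℕ => ‖LSeries.term (fun n => Skeleton.kappaZ c' D n) s₀ n‖ :=
    hsum.norm
  have hinj : Function.Injective fun l : ℕ => d₁ * l := mul_right_injective₀ hd₁.ne'
  have hcomp := hnorm.comp_injective hinj
  have hd₁' : (0 : ℝ) < d₁ := Nat.cast_pos.mpr hd₁
  refine ((hcomp.mul_left ((d₁ : ℝ) ^ (3 / 2 : ℝ))).congr fun l => ?_)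
  simp only [Function.comp_apply]
  rcases Nat.eq_zero_or_pos l with rfl | hl
  · simp [LSeries.term_zero, Real.zero_rpow (by norm_num : (-(3 / 2 : ℝ)) ≠ 0)]
  · have hne : d₁ * l ≠ 0 := Nat.mul_ne_zero hd₁.ne' hl.ne'
    have hl' : (0 : ℝ) < l := Nat.cast_pos.mpr hl
    rw [LSeries.norm_term_eq, if_neg hne, hre, Nat.cast_mul, Real.mul_rpow hd₁'.le hl'.le,
      Real.rpow_neg hl'.le]
    field_simp

/-! ## (7.19) -/

/-- **(7.19), for one modulus**: for `D ≥ 3`, `d₁ ≥ 1`, any `m` and any `y > 0`,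
`Σ'_{l≥1,(l,m)=1} κ(d₁l)Δ(l·y) = mellinInv (3/2) (s ↦ (Σ'_{(l,m)=1} κ(d₁l)l^{−s})·δ(s)) y` — Mellin
inversion termwise and the interchange of `Σ_l` with `∫_t`. [cite: Zhang2022LandauSiegel, (7.19) p.40] -/
theorem innerDeltaSum_eq_mellinInv (c' : ℝ) {D : ℕ} (hD : 3 ≤ D) {d₁ : ℕ} (hd₁ : 0 < d₁)
    (m : ℕ) {y : ℝ} (hy : 0 < y) :
    innerDeltaSum c' D d₁ m y =
      mellinInv (3 / 2) (fun s => kapSer c' D d₁ m s * Skeleton.deltaW D s) y := by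
  -- notation
  set δ : ℂ → ℂ := Skeleton.deltaW D with hδ
  set κ : ℕ → ℂ := fun n => Skeleton.kappaZ c' D n with hκ
  set sl : ℝ → ℂ := fun t => ((3 / 2 : ℝ) : ℂ) + t * I with hsl
  set coef : ℕ → ℂ := fun l => if 0 < l ∧ Nat.Coprime l m then κ (d₁ * l) else 0 with hcoef
  set c₀ : ℂ := ((1 / (2 * π) : ℝ) : ℂ) with hc₀
  set F : ℕ → ℝ → ℂ := fun l t =>
    c₀ * (coef l * ((((l : ℝ) * y : ℝ) : ℂ) ^ (-sl t) * δ (sl t))) with hF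
  have hsl_re : ∀ t : ℝ, (sl t).re = 3 / 2 := fun t => by simp [hsl]
  have hsl_ne : ∀ t : ℝ, -sl t ≠ 0 := fun t h => by
    have := congrArg Complex.re h
    rw [Complex.neg_re, hsl_re, Complex.zero_re] at this
    norm_num at this
  -- the integrable majorant data
  obtain ⟨K, hK0, hK⟩ := exists_norm_deltaW_line_le hD
  have hδint : Integrable fun t : ℝ => δ (sl t) := integrable_deltaW_line hD
  have hδnorm_int : Integrable fun t : ℝ => ‖δ (sl t)‖ := hδint.norm
  set I₀ : ℝ := ∫ t : ℝ, ‖δ (sl t)‖ with hI₀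
  have hI₀0 : 0 ≤ I₀ := integral_nonneg fun t => norm_nonneg _
  -- Step A: each summand of `innerDeltaSum` is `∫ F l`
  have hA : ∀ l : ℕ, (if 0 < l ∧ Nat.Coprime l m then κ (d₁ * l) * Skeleton.DeltaW D ((l : ℝ) * y)
      else 0) = ∫ t : ℝ, F l t := by
    intro l
    by_cases h : 0 < l ∧ Nat.Coprime l m
    · rw [if_pos h]
      have hly : 0 < (l : ℝ) * y := mul_pos (Nat.cast_pos.mpr h.1) hy
      rw [DeltaW_eq_mellinInv hD hly, mellinInv, Complex.real_smul, ← integral_const_mul,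
        ← integral_const_mul]
      refine integral_congr_ae (Eventually.of_forall fun t => ?_)
      simp only [hF, hcoef, if_pos h, smul_eq_mul, hc₀, hsl, hδ]
      ring
    · rw [if_neg h]
      have : F l = fun _ => 0 := by
        funext t; simp only [hF, hcoef, if_neg h, zero_mul, mul_zero]
      rw [this, integral_zero]
  -- Step B data: integrability of each `F l`
  have hF_int : ∀ l : ℕ, Integrable (F l) := by
    intro l
    rcases Nat.eq_zero_or_pos l with rfl | hl
    · have : F 0 = fun _ => 0 := by
        funext t
        simp only [hF, hcoef, lt_irrefl, false_and, if_false, zero_mul, mul_zero]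
      rw [this]; exact integrable_zero _ _ _
    · have hly : 0 < (l : ℝ) * y := mul_pos (Nat.cast_pos.mpr hl) hy
      have hpow : Integrable fun t : ℝ => ((((l : ℝ) * y : ℝ) : ℂ) ^ (-sl t)) * δ (sl t) := by
        refine hδint.bdd_mul (c := ((l : ℝ) * y) ^ (-(3 / 2 : ℝ))) ?_ ?_
        · exact (Continuous.const_cpow (by fun_prop) (Or.inr hsl_ne)).aestronglyMeasurable
        · refine Eventually.of_forall fun t => ?_
          rw [Complex.norm_cpow_eq_rpow_re_of_pos hly, Complex.neg_re, hsl_re]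
      have := hpow.const_mul (c₀ * coef l)
      refine this.congr (Eventually.of_forall fun t => ?_)
      simp only [hF]
      ring
  -- Step B data: summability of `l ↦ ∫ ‖F l‖`
  have hF_norm : ∀ l : ℕ, 0 < l → ∀ t : ℝ,
      ‖F l t‖ = (1 / (2 * π) * ‖coef l‖ * ((l : ℝ) * y) ^ (-(3 / 2 : ℝ))) * ‖δ (sl t)‖ := by
    intro l hl t
    have hly : 0 < (l : ℝ) * y := mul_pos (Nat.cast_pos.mpr hl) hy
    simp only [hF, norm_mul, hc₀, Complex.norm_real, Real.norm_eq_abs,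
      Complex.norm_cpow_eq_rpow_re_of_pos hly, Complex.neg_re, hsl_re]
    rw [abs_of_pos (by positivity)]
    ring
  have hcoef_le : ∀ l : ℕ, ‖coef l‖ ≤ ‖κ (d₁ * l)‖ := by
    intro l
    simp only [hcoef]
    split_ifs
    · exact le_rfl
    · rw [norm_zero]; exact norm_nonneg _
  have hF_sum : Summable fun l : ℕ => ∫ t : ℝ, ‖F l t‖ := by
    have hmaj : Summable fun l : ℕ =>
        (1 / (2 * π) * y ^ (-(3 / 2 : ℝ)) * I₀) * (‖κ (d₁ * l)‖ * (l : ℝ) ^ (-(3 / 2 : ℝ))) :=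
      (summable_norm_kappaZ_mul_rpow c' D hd₁).mul_left _
    refine Summable.of_nonneg_of_le (fun l => integral_nonneg fun t => norm_nonneg _)
      (fun l => ?_) hmaj
    rcases Nat.eq_zero_or_pos l with rfl | hl
    · have : (fun t : ℝ => ‖F 0 t‖) = fun _ => 0 := by
        funext t
        simp only [hF, hcoef, lt_irrefl, false_and, if_false, zero_mul, mul_zero, norm_zero]
      rw [this, integral_zero]
      have : (0 : ℝ) ≤ ‖κ (d₁ * 0)‖ * (((0 : ℕ) : ℝ)) ^ (-(3 / 2 : ℝ)) := by positivity
      positivity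
    · have hl' : (0 : ℝ) ≤ l := Nat.cast_nonneg l
      have hfun : (fun t : ℝ => ‖F l t‖) =
          fun t => (1 / (2 * π) * ‖coef l‖ * ((l : ℝ) * y) ^ (-(3 / 2 : ℝ))) * ‖δ (sl t)‖ := by
        funext t; exact hF_norm l hl t
      rw [hfun, integral_const_mul, Real.mul_rpow hl' hy.le]
      have h1 : 0 ≤ 1 / (2 * π) * (l : ℝ) ^ (-(3 / 2 : ℝ)) * y ^ (-(3 / 2 : ℝ)) * I₀ := by
        positivity
      calc 1 / (2 * π) * ‖coef l‖ * ((l : ℝ) ^ (-(3 / 2 : ℝ)) * y ^ (-(3 / 2 : ℝ))) * I₀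
          = ‖coef l‖ * (1 / (2 * π) * (l : ℝ) ^ (-(3 / 2 : ℝ)) * y ^ (-(3 / 2 : ℝ)) * I₀) := by
            ring
        _ ≤ ‖κ (d₁ * l)‖ * (1 / (2 * π) * (l : ℝ) ^ (-(3 / 2 : ℝ)) * y ^ (-(3 / 2 : ℝ)) * I₀) :=
            mul_le_mul_of_nonneg_right (hcoef_le l) h1
        _ = (1 / (2 * π) * y ^ (-(3 / 2 : ℝ)) * I₀) * (‖κ (d₁ * l)‖ * (l : ℝ) ^ (-(3 / 2 : ℝ))) := by
            ring
  -- Step C: the integrand, summed over `l`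
  have hC : ∀ t : ℝ, ∑' l : ℕ, F l t =
      c₀ * ((y : ℂ) ^ (-sl t) * (kapSer c' D d₁ m (sl t) * δ (sl t))) := by
    intro t
    have hterm : ∀ l : ℕ, F l t = (c₀ * ((y : ℂ) ^ (-sl t) * δ (sl t))) *
        LSeries.term (fun l => if Nat.Coprime l m then κ (d₁ * l) else 0) (sl t) l := by
      intro l
      rcases Nat.eq_zero_or_pos l with rfl | hl
      · simp only [hF, hcoef, lt_irrefl, false_and, if_false, zero_mul, mul_zero,
          LSeries.term_zero]
      · have hl0 : (l : ℂ) ≠ 0 := Nat.cast_ne_zero.mpr hl.ne'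
        rw [LSeries.term_of_ne_zero hl.ne']
        simp only [hF, hcoef, hl, true_and]
        have hsplit : ((((l : ℝ) * y : ℝ) : ℂ) ^ (-sl t)) = (l : ℂ) ^ (-sl t) * (y : ℂ) ^ (-sl t) := by
          rw [Complex.ofReal_mul, Complex.ofReal_natCast]
          have := Complex.mul_cpow_ofReal_nonneg (Nat.cast_nonneg l) hy.le (-sl t)
          rw [Complex.ofReal_natCast] at this
          exact this
        rw [hsplit, Complex.cpow_neg]
        split_ifs with hcop
        · field_simp
        · simp
    rw [tsum_congr hterm, tsum_mul_left, kapSer, LSeries]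
    ring
  -- Step D: assemble
  have hB := integral_tsum_of_summable_integral_norm hF_int hF_sum
  rw [innerDeltaSum]
  calc (∑' l : ℕ, if 0 < l ∧ Nat.Coprime l m then Skeleton.kappaZ c' D (d₁ * l) *
          Skeleton.DeltaW D ((l : ℝ) * y) else 0)
      = ∑' l : ℕ, ∫ t : ℝ, F l t := tsum_congr fun l => hA l
    _ = ∫ t : ℝ, ∑' l : ℕ, F l t := hB
    _ = ∫ t : ℝ, c₀ * ((y : ℂ) ^ (-sl t) * (kapSer c' D d₁ m (sl t) * δ (sl t))) :=
        integral_congr_ae (Eventually.of_forall fun t => hC t)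
    _ = mellinInv (3 / 2) (fun s => kapSer c' D d₁ m s * Skeleton.deltaW D s) y := by
        rw [mellinInv, Complex.real_smul, integral_const_mul]
        simp only [smul_eq_mul, hc₀, hsl, hδ]

/-- **(7.19) HOLDS** (the node `Section7dStatements.Eq719 c′`, for every `c′`; DAG `Z22:(7.19)`
[Z22 p.40, (7.19), tex L2093]): for all `D ≥ 3` (hence eventually; (A) is not used), every `p ∼ P`
and all positive `d₁, d₂, k, l₂`, the innermost sum `Σ_{(l,d₂k)=1} κ(d₁l)Δ(ll₂/(pk))` of (7.18)
equals `(1/2πi)∫_{(3/2)} (Σ_{(l,d₂k)=1} κ(d₁l)l^{−s})(pk/l₂)^s δ(s) ds`.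
[cite: Zhang2022LandauSiegel, (7.19) p.40] -/
theorem eq719_holds (c' : ℝ) : Eq719 c' := by
  refine ⟨3, fun D _ χ hD _ _ _ p hp d₁ d₂ k l₂ hd₁ _ hk hl₂ => ?_⟩
  have hp' : p.Prime := by
    simp only [Skeleton.primeWindow, Finset.mem_filter] at hp
    exact hp.2
  have hy : 0 < (l₂ : ℝ) / ((p : ℝ) * k) := by
    have : (0 : ℝ) < p := Nat.cast_pos.mpr hp'.pos
    have : (0 : ℝ) < k := Nat.cast_pos.mpr hk
    have : (0 : ℝ) < l₂ := Nat.cast_pos.mpr hl₂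
    positivity
  exact innerDeltaSum_eq_mellinInv c' hD hd₁ (d₂ * k) hy

variable (c' : ℝ) in
/-- `Eq719` — `_holds` alias of `eq719_holds` above under the fact's exact name, stated under the
prover's own binders as section variables (appended 2026-08-28, D-0026 bookkeeping: the proof term is the
existing theorem of this file; no statement, definition or attribute is edited; no new named fact; the
ledger's debt table listed the fact unproved). [cite: Zhang2022LandauSiegel, (7.19) p.40] -/
theorem _root_.Literature.NumberTheory.LFunctions.Zhang2022.Section7dStatements.Eq719_holds :
    _root_.Literature.NumberTheory.LFunctions.Zhang2022.Section7dStatements.Eq719 c' :=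
  _root_.Literature.NumberTheory.LFunctions.Zhang2022.Section7dStatements.eq719_holds (c' := c')

end Literature.NumberTheory.LFunctions.Zhang2022.Section7dStatements

end
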